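import Mathlib.Topology.Algebra.InfiniteSum.Basic
import Literature.MeasureTheory.Measure.DiscreteMeasureEqAbsolutelyContinuous   -- ★ bumps `bump`, `tendsto_bump_indicator`, `norm_bump_le_one`; ★ `tsum_smul_dirac_eq_integral_imp_weights_eq_zero` (injective `z`)
import HarnessLib

/-!
# R90-TF · S6 «Ch. 14.1–5 stable trace formula» — WAVE 1, W1-a: the FIBER WEIGHTS of a discrete measure that equals an
# absolutely continuous one VANISH (Langlands' «decomposition of measures» step, without injectivity of the support map)

Cell `hodgecm-mathlib`, crux H413 (`stmt-HodgeConjecture-24833`), route of record `HCCMUnconditional`; programme R90-TF (brief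
`director/R90-BRIEF.v2.md` 1f40d54518340a35), section S6 = Ch. 14.1–5 (base `R90-C14`), seat R90-C14-p01 (g0), target W1-a of the
section planner's sheet `R90/R90-C14-plan/g0/S6_wave1_targets.v1.R90-C14-plan-g0.lean` (sha16 9277fcdc85d681d1, :13–:18, signature
VERBATIM), a helper of the audited S6 socket `R90.S6.sock_S6_langlandsDichotomy : LanglandsDichotomy` (Lines file
`Cruxes/H413/Lines/R90_S6_StableTFSpectralB.lean`).  Helper file, lane `--supports stmt-HodgeConjecture-24833`; ONE theorem, no
definition, no instance, no notation, no `sorry`.  HONEST LABEL: HC_CM is proved only modulo the 7 printed citations (2 remaining named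
inputs: hLiu418 = stmt-HodgeConjecture-24832, h413 = stmt-HodgeConjecture-24833) until rung 0 closes; this file is generic measure
theory and proves no printed global statement.

THE MATHEMATICS.  ★ `Literature.MeasureTheory.Measure.tsum_smul_dirac_eq_integral_imp_weights_eq_zero` [Rogawski1990 §10.3
p. 159, proof of Thm. 10.3.1; §14.5 p. 241; Langlands1980 p. 211] proves: if `Σ_j c_j f(z_j) = ∫ f h dμ` for all continuous
`f : X → ℂ` (`μ` atomless, `h ∈ L¹(μ)`, `Σ ‖c_j‖ < ∞`) and the `z_j` are PAIRWISE DISTINCT, then every `c_j = 0`.  The S6 socket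
(the dichotomy of [Rogawski1990 §14.5 p. 241]: the discrete side of (14.5.1) is a sum over spectral parameters `z_j` that may
REPEAT) needs the same statement WITHOUT `Function.Injective z`: then what vanishes is every FIBER SUM `Σ_{j : z_j = x₀} c_j`.
PROOF (the ★ bump argument run at an arbitrary point `x₀`): test the identity against the continuous bumps
`bₙ(x) = max(1 − n·d(x, x₀), 0)`; `bₙ → 𝟙_{x₀}` pointwise with `|bₙ| ≤ 1`, so by dominated convergence for series (Tannery) the
discrete side tends to `Σ_j c_j 𝟙[z_j = x₀] = Σ_{j : z_j = x₀} c_j` (`tsum_subtype`), and by Lebesgue's dominated convergence the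
continuous side tends to `∫ 𝟙_{x₀} h dμ = 0` (because `μ {x₀} = 0`); limits are unique.  The hypothesis `[CompactSpace X]` of the
sheet is carried verbatim (junction rule) and not used.

## References
* [Rogawski1990] J. D. Rogawski, *Automorphic Representations of Unitary Groups in Three Variables*, Ann. of Math. Stud. 123
  (1990): §10.3 p. 159 (proof of Thm. 10.3.1); §14.5 p. 241 (vanishing of the right-hand side of (14.5.1)).
* [Langlands1980] R. P. Langlands, *Base change for GL(2)*, Ann. of Math. Stud. 96 (1980), p. 211 (cited via Rogawski).
-/

set_option autoImplicit false
-- the mandated namespace repeats the single-problem summit's segment (`HodgeConjecture.HodgeConjecture`)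
set_option linter.dupNamespace false

noncomputable section

open MeasureTheory Filter Topology
open Literature.MeasureTheory.Measure

namespace Summit.HodgeConjecture.HodgeConjecture.R90.S6

open scoped Classical in
/-- **W1-a · fiber weights vanish** (Langlands' «decomposition of measures» lemma, weights form, WITHOUT injectivity of `z`)
[Rogawski1990 §10.3 p. 159 (proof of Thm. 10.3.1); §14.5 p. 241; Langlands1980 p. 211]: let `μ` be a Borel measure without
atoms (`μ {x} = 0` for every `x`) on a metric space `X`, `h ∈ L¹(μ)`, `z : ι → X` any family of points and `c : ι → ℂ`
weights with `Σ ‖c_j‖ < ∞`.  If `Σ_j c_j f(z_j) = ∫ f h dμ` for every continuous `f : X → ℂ`, then for every `x₀ : X` the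
fiber sum `Σ_{j : z_j = x₀} c_j` is `0`.  (Signature verbatim from the S6 WAVE 1 sheet, W1-a; generalises ★
`tsum_smul_dirac_eq_integral_imp_weights_eq_zero`, which assumes `z` injective.) -/
theorem fiberWeights_eq_zero {X : Type*} [MetricSpace X] [CompactSpace X] [MeasurableSpace X] [BorelSpace X]
    {μ : Measure X} (hμ : ∀ x : X, μ {x} = 0) {h : X → ℂ} (hh : Integrable h μ)
    {ι : Type*} (z : ι → X) {c : ι → ℂ} (hc : Summable fun j => ‖c j‖)
    (heq : ∀ f : C(X, ℂ), ∑' j, c j * f (z j) = ∫ x, f x * h x ∂μ) (x₀ : X) :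
    ∑' j : {j : ι // z j = x₀}, c j = 0 := by
  -- the discrete side along the bumps at `x₀` tends to `Σ_j c_j · 𝟙[z_j = x₀]` (Tannery)
  have hF : Tendsto (fun n => ∑' j, c j * bump x₀ n (z j)) atTop
      (𝓝 (∑' j, c j * (if z j = x₀ then 1 else 0))) := by
    refine tendsto_tsum_of_dominated_convergence (bound := fun j => ‖c j‖) hc
      (fun j => (tendsto_bump_indicator x₀ (z j)).const_mul (c j)) (Eventually.of_forall fun n j => ?_)
    rw [norm_mul]
    exact mul_le_of_le_one_right (norm_nonneg _) (norm_bump_le_one _ _ _)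
  -- … which is the fiber sum over `{j : z j = x₀}`
  have hsum : ∑' j, c j * (if z j = x₀ then (1 : ℂ) else 0) = ∑' j : {j : ι // z j = x₀}, c j := by
    have h1 : (fun j => c j * (if z j = x₀ then (1 : ℂ) else 0)) = Set.indicator {j | z j = x₀} c := by
      funext j
      simp only [Set.indicator_apply, Set.mem_setOf_eq, mul_ite, mul_one, mul_zero]
    rw [h1]
    exact (tsum_subtype {j | z j = x₀} c).symm
  rw [hsum] at hF
  -- the continuous side tends to `∫ 𝟙_{x₀} h dμ` (Lebesgue's dominated convergence)
  have hG : Tendsto (fun n => ∫ x, bump x₀ n x * h x ∂μ) atTop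
      (𝓝 (∫ x, (if x = x₀ then (1 : ℂ) else 0) * h x ∂μ)) := by
    refine tendsto_integral_of_dominated_convergence (bound := fun x => ‖h x‖)
      (fun n => ((bump x₀ n).continuous.aestronglyMeasurable).mul hh.aestronglyMeasurable) hh.norm
      (fun n => Eventually.of_forall fun x => ?_)
      (Eventually.of_forall fun x => (tendsto_bump_indicator x₀ x).mul_const (h x))
    rw [norm_mul]
    exact mul_le_of_le_one_left (norm_nonneg _) (norm_bump_le_one _ _ _)
  -- … which is `0` because `μ {x₀} = 0`
  have hzero : ∫ x, (if x = x₀ then (1 : ℂ) else 0) * h x ∂μ = 0 := by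
    refine integral_eq_zero_of_ae ?_
    refine measure_mono_null (fun x hx => ?_) (hμ x₀)
    -- off `x₀` the integrand vanishes
    by_contra hxk
    have hxk' : x ≠ x₀ := hxk
    exact hx (by simp only [Set.mem_setOf_eq, if_neg hxk', zero_mul, Pi.zero_apply])
  rw [hzero] at hG
  -- the two sides agree along the bumps, and limits are unique
  have hFG : (fun n => ∑' j, c j * bump x₀ n (z j)) = fun n => ∫ x, bump x₀ n x * h x ∂μ :=
    funext fun n => heq (bump x₀ n)
  rw [hFG] at hF
  exact tendsto_nhds_unique hF hG

end Summit.HodgeConjecture.HodgeConjecture.R90.S6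

end
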